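import Summits.NavierStokesRegularity.FluidComputer.PalasekTowerLundgrenChildGaussianHandover
import Literature.Analysis.FluidPDE.PlanarLambOseen

/-!
# REGISTER v2.3″ (continued): THE CORE LOG CLOCK WITH THE SHARP CAPTURE FACTOR — the circulation endowment
# `0.86·c₁N_{k+1}^{β−2}` of the co-signed clock drops to `0.2565·c₁N_{k+1}^{β−2}` once `x_k ≥ 52`
# (tuned rates: every level, every `λ ≥ 1/4`), and to the floor `(1/4)·c₁N_{k+1}^{β−2}` in the limit

Cell `ns-blowup`, seat `ns-blowup-ecbridge-8` (g11); evidence toward crux stmt-NavierStokesRegularity-20305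
`HeredityFromTwoT` (standing record 19250), floor `CoreFloorAt k`, MODEL lane «child core = cross-section of
Lundgren's stretched flow in the host strain `c = λA_k` at `ν = 1`». Answers the g10 honest gap (e) / refuter4 K197 (2):
`palasekTowerBreakdown_cosigned_child_coreClause_logClock` (`PalasekTowerLundgrenChildCoreClockNonneg` §2) traded the
capture factor `1 − e^{−x_k/4}` of the Lundgren Gaussian inside the core-ledger radius for the level-free bound
`1 − (1 + x_k/4)⁻¹ ≥ 0.3277` at `x_k ≥ 1.95`, whence the endowment constant `0.86` (`4·0.86·(0.3277 − 1/40) > 1`).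
The register's core ratio is large (`x_k = λN_k^{β−2b}`, tuned `N_k^{β−2b} = 2^{8.1·(33/32)^k} ≥ 256`), so the sharp
factor is `1` to twenty-seven digits and the honest endowment requirement of this lane is a quarter of the clause (the
ledger loop is wound four times) plus the clock defect:

* §1 `palasekTowerBreakdown_cosigned_child_coreClause_logClock_sharp` — any rates, any schedule, any level, any
  `λ > 0`: **`3200·H₀ ≤ Γe^{λA_k s}` and `c₁N_{k+1}^{β−2}/4 ≤ Γ·(1 − e^{−x_k/4} − 1/40)` ⇒ the level-`(k+1)` core
  clause at strain time `s`** (the co-signed setting verbatim; `x_k = λN_k^{β−2b}`);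
* §2 `…_logClock_sharp52` — `x_k ≥ 52` (`e^{−x_k/4} ≤ e^{−13} < 1/439 040`): **`Γ ≥ 0.2565·c₁N_{k+1}^{β−2}`**
  suffices (`0.2565·0.97499 > 1/4`), a factor `3.35` below `0.86`;
* §3 `TowerRates.tuned_clock_thirteen` (public form of the clock number used privately in `…OseenRun` §5 and
  `…OseenPairRun` §1: `A_k s ≥ 13·(33/32)^k ⇒ 1600·N_k^{β−2b} ≤ e^{A_k s}` at the tuned rates, every level) and
  `…_logClock_tunedSharp` — `TowerRates.tuned`, every level, every `λ ≥ 1/4` (`x_k ≥ 64`): the `0.2565` endowment;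
* §4 `palasekTowerBreakdown_oseenRun_child_coreClause_tuned_allLevels_sharp` — the Oseen-seeded child of
  `PalasekTowerLundgrenChildOseenRun` §5 with the sharp endowment: **tuned, EVERY level `k`, `λ = 1`, heat age
  `1/(2N_{k+1}²)`, every schedule: `A_k s ≥ 13·(33/32)^k ∧ Γ ≥ 0.2565·c₁N_{k+1}^{β−2}` ⇒ the level-`(k+1)` core
  clause**, every planar-run hypothesis discharged by `Literature.Analysis.FluidPDE.PlanarLambOseen`.

REGISTER READING (arithmetic on displayed constants, not a theorem): with a longer clock `M·H₀ ≤ Γe^{λA_k s}` the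
defect term `(2/M)^{1/2}` replaces `1/40`, so the endowment constant of this lane tends to `1/4` and not below — the
four windings of the ledger loop are what convert a core carrying `Γ ≥ c₁N_{k+1}^{β−2}/4` into the clause. WHAT THIS
IS NOT: not NS about registered flows; no registered `Stage` is constructed; the endowment `Γ` itself (refuter4 K193:
the child's circulation in floor units) is a HYPOTHESIS here exactly as in g10; the vacuity of the register stands.

## References
* [cite: GallayWayne2005, §1 (the Oseen vortices), Lemma 3.2 and §3.4] · [cite: Palasek2026ElementaryModel, §3 (3.2), §3.1]
-/

noncomputable section

namespace Summit.NavierStokesRegularity.FluidComputer.PalasekTowerClayBridge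

open Real Set MeasureTheory Function
open scoped RealInnerProductSpace ContDiff
open Literature.Analysis.FluidPDE Literature.Analysis.FluidPDE.Lundgren Literature.Analysis.Calculus
open CoreLedgerStokes CoreClock

variable {S S' : Set ℝ}
  {v : ℝ → EuclideanSpace ℝ (Fin 2) → EuclideanSpace ℝ (Fin 2)}
  {q : ℝ → EuclideanSpace ℝ (Fin 2) → ℝ} {w : ℝ → EuclideanSpace ℝ (Fin 2) → ℝ}

/-! ### §1 The log clock with the sharp capture factor `1 − e^{−x_k/4}` -/

/-- **THE CORE LOG CLOCK WITH THE SHARP CAPTURE FACTOR** (any rates `R`, any schedule, any level `k`, any `λ > 0`;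
the co-signed setting of `palasekTowerBreakdown_cosigned_child_coreClause`): if the strain clock has run
`3200·H₀ ≤ Γe^{λA_k s}` (so the relaxation defect is at most `Γ/40`) and the circulation endowment satisfies
**`c₁N_{k+1}^{β−2}/4 ≤ Γ·(1 − e^{−x_k/4} − 1/40)`**, `x_k = λN_k^{β−2b}` (`λA_k/(4N_{k+1}²) = x_k/4`,
`palasekTowerBreakdown_coreRatio_eq`), then the child's flow at strain time `s` meets the level-`(k+1)` core clause on
every cross-section `{x₂ = z₀}`, `|z₀| ≤ radius`. The g10 statement `…_coreClause_logClock` is the case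
`1 − e^{−x/4} ≥ 0.3277` (`x ≥ 1.95`) with `Γ ≥ 0.86·c₁N_{k+1}^{β−2}`. MODEL statement; not about any registered flow.
[cite: GallayWayne2005, Lemma 3.2 and §3.4; Palasek2026ElementaryModel, §3.1] -/
theorem palasekTowerBreakdown_cosigned_child_coreClause_logClock_sharp (R : TowerRates) (Sch : Schedule R)
    (k : ℕ) {l : ℝ} (hl : 0 < l) (hS' : Convex ℝ S') (hv : IsClassicalNSSolutionOn S' 1 0 v q)
    (hω : HasUniformRapidDecayOn S' (fun σ η => PlanarEigenmode.vorticity (v σ) η))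
    (hBS : ∀ σ ∈ S', ∀ η, v σ η = biotSavart2D (PlanarEigenmode.vorticity (v σ)) η)
    (h0nn : ∀ η, 0 ≤ PlanarEigenmode.vorticity (v 0) η)
    (hΓ : 0 < ∫ y, PlanarEigenmode.vorticity (v 0) y)
    (hw : IsSmoothSpaceTimeOn S' w)
    (hmaps : MapsTo (fun t => (exp (l * R.A k * t) - 1) / (l * R.A k)) S S')
    (h0 : (0 : ℝ) ∈ S') {s : ℝ} (hsS : s ∈ S) (hs : 0 ≤ s) {z₀ : ℝ} (hz₀ : |z₀| ≤ Sch.radius)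
    (hH : 3200 * (∫ η, PlanarEigenmode.vorticity (v 0) η *
        Real.log (PlanarEigenmode.vorticity (v 0) η /
          ((∫ y, PlanarEigenmode.vorticity (v 0) y) / (4 * π * (l * R.A k)⁻¹) *
            exp (-(‖η‖ ^ 2 / (4 * (l * R.A k)⁻¹)))))) ≤
      (∫ y, PlanarEigenmode.vorticity (v 0) y) * exp (l * R.A k * s))
    (hC : Sch.c₁ * R.N (k + 1) ^ (R.β - 2) / 4 ≤
      (∫ y, PlanarEigenmode.vorticity (v 0) y) *
        (1 - exp (-(l * R.N k ^ (R.β - 2 * R.b) / 4)) - 1 / 40)) :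
    ∃ (x' : EuclideanSpace ℝ (Fin 3)) (γ : ℝ → EuclideanSpace ℝ (Fin 3)),
      ‖x'‖ ≤ Sch.radius ∧ ContDiff ℝ 1 γ ∧ γ 0 = γ 1 ∧
      (∀ σ ∈ Icc (0 : ℝ) 1, γ σ ∈ Metric.closedBall x' (1 / R.N (k + 1))) ∧
      (∀ σ ∈ Icc (0 : ℝ) 1, ‖deriv γ σ‖ ≤ 8 * π / R.N (k + 1)) ∧
      Sch.c₁ * R.N (k + 1) ^ (R.β - 2) ≤
        circulation (velocity (fun _ => l * R.A k)
          (fun t y => exp (l * R.A k * t / 2) •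
            v ((exp (l * R.A k * t) - 1) / (l * R.A k)) (exp (l * R.A k * t / 2) • y))
          (fun t y => exp (-(l * R.A k * t)) •
            w ((exp (l * R.A k * t) - 1) / (l * R.A k)) (exp (l * R.A k * t / 2) • y)) s) γ := by
  set c : ℝ := l * R.A k with hc
  have hcpos : 0 < c := mul_pos hl (R.A_pos k)
  set Γ : ℝ := ∫ y, PlanarEigenmode.vorticity (v 0) y with hΓdef
  have hΓ0 : 0 ≤ Γ := hΓ.le
  set H₀ : ℝ := ∫ η, PlanarEigenmode.vorticity (v 0) η *
    Real.log (PlanarEigenmode.vorticity (v 0) η / (Γ / (4 * π * c⁻¹) * exp (-(‖η‖ ^ 2 / (4 * c⁻¹)))))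
    with hH₀
  refine palasekTowerBreakdown_cosigned_child_coreClause R Sch k hl hS' hv hω hBS h0nn hΓ hw hmaps h0 hsS hs
    hz₀ ?_
  -- `λA_k/(4N_{k+1}²) = x_k/4`
  set x : ℝ := l * R.N k ^ (R.β - 2 * R.b) with hxdef
  have hxq : c / (4 * R.N (k + 1) ^ 2) = x / 4 := by
    rw [hxdef, hc, ← palasekTowerBreakdown_coreRatio_eq]; ring
  -- the clock defect `(2ΓH₀)^{1/2} e^{−cs/2} ≤ Γ/40` from `3200 H₀ ≤ Γ e^{cs}`
  have hE : 0 ≤ exp (-(c * s / 2)) := (exp_pos _).le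
  have hE2 : exp (-(c * s / 2)) ^ 2 * exp (c * s) = 1 := by
    rw [sq, ← Real.exp_add, ← Real.exp_add, show -(c * s / 2) + -(c * s / 2) + c * s = 0 by ring,
      Real.exp_zero]
  have hkey : 2 * Γ * H₀ * exp (-(c * s / 2)) ^ 2 ≤ (Γ / 40) ^ 2 := by
    have hfac : 2 * Γ * H₀ * exp (-(c * s / 2)) ^ 2 =
        Γ * exp (-(c * s / 2)) ^ 2 / 1600 * (3200 * H₀) := by
      ring
    rw [hfac]
    calc Γ * exp (-(c * s / 2)) ^ 2 / 1600 * (3200 * H₀)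
        ≤ Γ * exp (-(c * s / 2)) ^ 2 / 1600 * (Γ * exp (c * s)) :=
          mul_le_mul_of_nonneg_left hH (by positivity)
      _ = (Γ / 40) ^ 2 * (exp (-(c * s / 2)) ^ 2 * exp (c * s)) := by ring
      _ = (Γ / 40) ^ 2 := by rw [hE2, mul_one]
  have hdef : Real.sqrt (2 * Γ * H₀) * exp (-(c * s / 2)) ≤ Γ / 40 := by
    calc Real.sqrt (2 * Γ * H₀) * exp (-(c * s / 2))
        = Real.sqrt (2 * Γ * H₀) * Real.sqrt (exp (-(c * s / 2)) ^ 2) := by rw [Real.sqrt_sq hE]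
      _ = Real.sqrt (2 * Γ * H₀ * exp (-(c * s / 2)) ^ 2) := (Real.sqrt_mul' _ (sq_nonneg _)).symm
      _ ≤ Real.sqrt ((Γ / 40) ^ 2) := Real.sqrt_le_sqrt hkey
      _ = Γ / 40 := Real.sqrt_sq (by positivity)
  rw [hxq]
  have hle : Γ * (1 - exp (-(x / 4)) - 1 / 40) ≤
      Γ * (1 - exp (-(x / 4))) - Real.sqrt (2 * Γ * H₀) * exp (-(c * s / 2)) := by
    nlinarith [hdef]
  exact hC.trans hle

/-! ### §2 Large core ratio: the endowment constant `0.2565` -/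

/-- `e^{13} > 439 040` (`e > 2.718`, `2.718^{13} > 439 040`). [folklore] -/
private theorem exp_thirteen_gt : (439040 : ℝ) < exp 13 := by
  have he : (2.7182818283 : ℝ) < exp 1 := Real.exp_one_gt_d9
  have hpow : (2.718 : ℝ) ^ 13 < exp 1 ^ 13 := pow_lt_pow_left₀ (by linarith) (by norm_num) (by norm_num)
  have h13' : exp 13 = exp 1 ^ 13 := by rw [← Real.exp_nat_mul]; norm_num
  have hnum : (439040 : ℝ) < (2.718 : ℝ) ^ 13 := by norm_num
  linarith

/-- The sharp capture factor less the clock defect is at least `0.97499` once `x ≥ 52`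
(`e^{−x/4} ≤ e^{−13} < 1/439 040`). [folklore] -/
private theorem captureFactor_ge {x : ℝ} (hx : 52 ≤ x) : 0.97499 ≤ 1 - exp (-(x / 4)) - 1 / 40 := by
  have h1 : exp (-(x / 4)) ≤ exp (-13) := exp_le_exp.2 (by linarith)
  have h2 : exp (-13) ≤ 1 / 439040 := by
    rw [Real.exp_neg, ← one_div]
    exact one_div_le_one_div_of_le (by norm_num) exp_thirteen_gt.le
  linarith

/-- **THE ENDOWMENT CONSTANT `0.2565` AT CORE RATIO `x_k ≥ 52`** (any rates, any schedule, any level, any `λ > 0`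
with `λN_k^{β−2b} ≥ 52`; the co-signed setting): **`3200·H₀ ≤ Γe^{λA_k s}` and `Γ ≥ 0.2565·c₁N_{k+1}^{β−2}` ⇒ the
level-`(k+1)` core clause at strain time `s`** (`1 − e^{−x_k/4} − 1/40 ≥ 0.97499`, `0.2565·0.97499 > 1/4`) — a factor
`3.35` below the `0.86` of `…_coreClause_logClock`. MODEL statement; not about any registered flow.
[cite: GallayWayne2005, Lemma 3.2 and §3.4; Palasek2026ElementaryModel, §3.1] -/
theorem palasekTowerBreakdown_cosigned_child_coreClause_logClock_sharp52 (R : TowerRates) (Sch : Schedule R)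
    (k : ℕ) {l : ℝ} (hl : 0 < l) (hS' : Convex ℝ S') (hv : IsClassicalNSSolutionOn S' 1 0 v q)
    (hω : HasUniformRapidDecayOn S' (fun σ η => PlanarEigenmode.vorticity (v σ) η))
    (hBS : ∀ σ ∈ S', ∀ η, v σ η = biotSavart2D (PlanarEigenmode.vorticity (v σ)) η)
    (h0nn : ∀ η, 0 ≤ PlanarEigenmode.vorticity (v 0) η)
    (hΓ : 0 < ∫ y, PlanarEigenmode.vorticity (v 0) y)
    (hw : IsSmoothSpaceTimeOn S' w)
    (hmaps : MapsTo (fun t => (exp (l * R.A k * t) - 1) / (l * R.A k)) S S')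
    (h0 : (0 : ℝ) ∈ S') {s : ℝ} (hsS : s ∈ S) (hs : 0 ≤ s) {z₀ : ℝ} (hz₀ : |z₀| ≤ Sch.radius)
    (hx : 52 ≤ l * R.N k ^ (R.β - 2 * R.b))
    (hH : 3200 * (∫ η, PlanarEigenmode.vorticity (v 0) η *
        Real.log (PlanarEigenmode.vorticity (v 0) η /
          ((∫ y, PlanarEigenmode.vorticity (v 0) y) / (4 * π * (l * R.A k)⁻¹) *
            exp (-(‖η‖ ^ 2 / (4 * (l * R.A k)⁻¹)))))) ≤
      (∫ y, PlanarEigenmode.vorticity (v 0) y) * exp (l * R.A k * s))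
    (hC : 0.2565 * Sch.c₁ * R.N (k + 1) ^ (R.β - 2) ≤ ∫ y, PlanarEigenmode.vorticity (v 0) y) :
    ∃ (x' : EuclideanSpace ℝ (Fin 3)) (γ : ℝ → EuclideanSpace ℝ (Fin 3)),
      ‖x'‖ ≤ Sch.radius ∧ ContDiff ℝ 1 γ ∧ γ 0 = γ 1 ∧
      (∀ σ ∈ Icc (0 : ℝ) 1, γ σ ∈ Metric.closedBall x' (1 / R.N (k + 1))) ∧
      (∀ σ ∈ Icc (0 : ℝ) 1, ‖deriv γ σ‖ ≤ 8 * π / R.N (k + 1)) ∧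
      Sch.c₁ * R.N (k + 1) ^ (R.β - 2) ≤
        circulation (velocity (fun _ => l * R.A k)
          (fun t y => exp (l * R.A k * t / 2) •
            v ((exp (l * R.A k * t) - 1) / (l * R.A k)) (exp (l * R.A k * t / 2) • y))
          (fun t y => exp (-(l * R.A k * t)) •
            w ((exp (l * R.A k * t) - 1) / (l * R.A k)) (exp (l * R.A k * t / 2) • y)) s) γ := by
  have hNβ : 0 < R.N (k + 1) ^ (R.β - 2) := Real.rpow_pos_of_pos (R.N_pos _) _
  have hc₁ := Sch.c₁_pos
  have hΓ0 := hΓ.le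
  refine palasekTowerBreakdown_cosigned_child_coreClause_logClock_sharp R Sch k hl hS' hv hω hBS h0nn hΓ hw hmaps
    h0 hsS hs hz₀ hH ?_
  have hcap := captureFactor_ge hx
  nlinarith [mul_le_mul_of_nonneg_left hcap hΓ0,
    mul_le_mul_of_nonneg_right hC (by norm_num : (0 : ℝ) ≤ 0.97499), mul_pos hc₁ hNβ]

/-! ### §3 The tuned rates: the clock number at every level and the endowment `0.2565` for every `λ ≥ 1/4` -/

/-- `1600·2^{8.1t} ≤ e^{13t}` for every `t ≥ 1` (`1600·2^{8.1} < 439 040 < e^{13}`, then `t`-th powers).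
[folklore] -/
private theorem sixteen_hundred_mul_two_rpow_le_exp_sharp {t : ℝ} (ht : 1 ≤ t) :
    1600 * (2 : ℝ) ^ ((81 : ℝ) / 10 * t) ≤ exp (13 * t) := by
  have ht0 : 0 ≤ t := zero_le_one.trans ht
  have hxlt : (2 : ℝ) ^ ((81 : ℝ) / 10) < 274.4 := by
    have hp : ((2 : ℝ) ^ ((81 : ℝ) / 10)) ^ (10 : ℕ) = 2 ^ (81 : ℕ) := by
      rw [← Real.rpow_natCast, ← Real.rpow_mul (by norm_num : (0 : ℝ) ≤ 2)]
      norm_num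
    refine lt_of_pow_lt_pow_left₀ 10 (by norm_num) ?_
    rw [hp]; norm_num
  have hbase : 1600 * (2 : ℝ) ^ ((81 : ℝ) / 10) ≤ exp 13 := by
    nlinarith [Real.rpow_pos_of_pos two_pos ((81 : ℝ) / 10), exp_thirteen_gt]
  have h2pos : 0 < (2 : ℝ) ^ ((81 : ℝ) / 10) := Real.rpow_pos_of_pos two_pos _
  have h1600 : (1600 : ℝ) ≤ 1600 ^ t := by
    calc (1600 : ℝ) = 1600 ^ (1 : ℝ) := (Real.rpow_one _).symm
      _ ≤ 1600 ^ t := Real.rpow_le_rpow_of_exponent_le (by norm_num) ht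
  calc 1600 * (2 : ℝ) ^ ((81 : ℝ) / 10 * t)
      = 1600 * ((2 : ℝ) ^ ((81 : ℝ) / 10)) ^ t := by rw [Real.rpow_mul (by norm_num : (0 : ℝ) ≤ 2)]
    _ ≤ 1600 ^ t * ((2 : ℝ) ^ ((81 : ℝ) / 10)) ^ t :=
        mul_le_mul_of_nonneg_right h1600 (Real.rpow_nonneg h2pos.le t)
    _ = (1600 * (2 : ℝ) ^ ((81 : ℝ) / 10)) ^ t := by rw [Real.mul_rpow (by norm_num) h2pos.le]
    _ ≤ (exp 13) ^ t := Real.rpow_le_rpow (by positivity) hbase ht0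
    _ = exp (13 * t) := by rw [← Real.exp_mul]

/-- **The tuned clock number at every level**: `A_k s ≥ 13·(33/32)^k ⇒ 1600·N_k^{β−2b} ≤ e^{A_k s}`
(`TowerRates.tuned`: `N_k^{β−2b} = 2^{8.1·(33/32)^k}`, `1600·2^{8.1t} ≤ e^{13t}` for `t = (33/32)^k ≥ 1`). The public
form of the number used in `PalasekTowerLundgrenChildOseenRun` §5 and `…OseenPairRun` §4. [folklore] -/
theorem TowerRates.tuned_clock_thirteen (k : ℕ) {s : ℝ}
    (hs13 : 13 * (33 / 32 : ℝ) ^ k ≤ TowerRates.tuned.A k * s) :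
    1600 * TowerRates.tuned.N k ^ (TowerRates.tuned.β - 2 * TowerRates.tuned.b) ≤
      exp (TowerRates.tuned.A k * s) := by
  have hbk : (1 : ℝ) ≤ (33 / 32 : ℝ) ^ k := one_le_pow₀ (by norm_num)
  have hxeq : TowerRates.tuned.N k ^ (TowerRates.tuned.β - 2 * TowerRates.tuned.b) =
      (2 : ℝ) ^ ((81 : ℝ) / 10 * (33 / 32 : ℝ) ^ k) := by
    rw [TowerRates.tuned_N_eq_two_rpow, ← Real.rpow_mul (by norm_num : (0 : ℝ) ≤ 2)]
    simp only [TowerRates.tuned]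
    ring_nf
  rw [hxeq]
  refine (sixteen_hundred_mul_two_rpow_le_exp_sharp hbk).trans (exp_le_exp.2 ?_)
  linarith

/-- **THE ENDOWMENT `0.2565` AT THE TUNED RATES, EVERY LEVEL, EVERY `λ ≥ 1/4`** (`x_k = λN_k^{β−2b} ≥ 256λ ≥ 64`;
the co-signed setting): **`3200·H₀ ≤ Γe^{λA_k s}` and `Γ ≥ 0.2565·c₁N_{k+1}^{β−2}` ⇒ the level-`(k+1)` core clause at
strain time `s`**. MODEL statement; not about any registered flow.
[cite: GallayWayne2005, Lemma 3.2 and §3.4; Palasek2026ElementaryModel, §3 (3.2), §3.1] -/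
theorem palasekTowerBreakdown_cosigned_child_coreClause_logClock_tunedSharp (Sch : Schedule TowerRates.tuned)
    (k : ℕ) {l : ℝ} (hl : 1 / 4 ≤ l) (hS' : Convex ℝ S') (hv : IsClassicalNSSolutionOn S' 1 0 v q)
    (hω : HasUniformRapidDecayOn S' (fun σ η => PlanarEigenmode.vorticity (v σ) η))
    (hBS : ∀ σ ∈ S', ∀ η, v σ η = biotSavart2D (PlanarEigenmode.vorticity (v σ)) η)
    (h0nn : ∀ η, 0 ≤ PlanarEigenmode.vorticity (v 0) η)
    (hΓ : 0 < ∫ y, PlanarEigenmode.vorticity (v 0) y)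
    (hw : IsSmoothSpaceTimeOn S' w)
    (hmaps : MapsTo (fun t => (exp (l * TowerRates.tuned.A k * t) - 1) / (l * TowerRates.tuned.A k)) S S')
    (h0 : (0 : ℝ) ∈ S') {s : ℝ} (hsS : s ∈ S) (hs : 0 ≤ s) {z₀ : ℝ} (hz₀ : |z₀| ≤ Sch.radius)
    (hH : 3200 * (∫ η, PlanarEigenmode.vorticity (v 0) η *
        Real.log (PlanarEigenmode.vorticity (v 0) η /
          ((∫ y, PlanarEigenmode.vorticity (v 0) y) / (4 * π * (l * TowerRates.tuned.A k)⁻¹) *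
            exp (-(‖η‖ ^ 2 / (4 * (l * TowerRates.tuned.A k)⁻¹)))))) ≤
      (∫ y, PlanarEigenmode.vorticity (v 0) y) * exp (l * TowerRates.tuned.A k * s))
    (hC : 0.2565 * Sch.c₁ * TowerRates.tuned.N (k + 1) ^ (TowerRates.tuned.β - 2) ≤
      ∫ y, PlanarEigenmode.vorticity (v 0) y) :
    ∃ (x' : EuclideanSpace ℝ (Fin 3)) (γ : ℝ → EuclideanSpace ℝ (Fin 3)),
      ‖x'‖ ≤ Sch.radius ∧ ContDiff ℝ 1 γ ∧ γ 0 = γ 1 ∧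
      (∀ σ ∈ Icc (0 : ℝ) 1, γ σ ∈ Metric.closedBall x' (1 / TowerRates.tuned.N (k + 1))) ∧
      (∀ σ ∈ Icc (0 : ℝ) 1, ‖deriv γ σ‖ ≤ 8 * π / TowerRates.tuned.N (k + 1)) ∧
      Sch.c₁ * TowerRates.tuned.N (k + 1) ^ (TowerRates.tuned.β - 2) ≤
        circulation (velocity (fun _ => l * TowerRates.tuned.A k)
          (fun t y => exp (l * TowerRates.tuned.A k * t / 2) •
            v ((exp (l * TowerRates.tuned.A k * t) - 1) / (l * TowerRates.tuned.A k))
              (exp (l * TowerRates.tuned.A k * t / 2) • y))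
          (fun t y => exp (-(l * TowerRates.tuned.A k * t)) •
            w ((exp (l * TowerRates.tuned.A k * t) - 1) / (l * TowerRates.tuned.A k))
              (exp (l * TowerRates.tuned.A k * t / 2) • y)) s) γ := by
  have hl0 : 0 < l := by linarith
  have h256 := TowerRates.tuned_coreRatio_ge k
  have hx : 52 ≤ l * TowerRates.tuned.N k ^ (TowerRates.tuned.β - 2 * TowerRates.tuned.b) := by
    have h := mul_le_mul hl h256 (by norm_num) hl0.le
    linarith
  exact palasekTowerBreakdown_cosigned_child_coreClause_logClock_sharp52 TowerRates.tuned Sch k hl0 hS' hv hω hBS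
    h0nn hΓ hw hmaps h0 hsS hs hz₀ hx hH hC

/-! ### §4 The Oseen-seeded child at the tuned rates, every level, with the sharp endowment -/

/-- The Lundgren clock `t ↦ (e^{ct} − 1)/c` (`c > 0`) maps `[0, s]` into `[0, (e^{cs} − 1)/c]`. [folklore] -/
private theorem mapsTo_lundgrenClock_Icc_sharp {c s : ℝ} (hc : 0 < c) :
    MapsTo (fun t => (exp (c * t) - 1) / c) (Icc 0 s) (Icc 0 ((exp (c * s) - 1) / c)) := by
  intro t ht
  refine ⟨div_nonneg ?_ hc.le, div_le_div_of_nonneg_right ?_ hc.le⟩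
  · have : 1 ≤ exp (c * t) := one_le_exp (by nlinarith [ht.1])
    linarith
  · have : exp (c * t) ≤ exp (c * s) := exp_le_exp.2 (by nlinarith [ht.2])
    linarith

/-- **EVERY LEVEL OF THE TUNED RATES WITH THE SHARP ENDOWMENT** (`TowerRates.tuned`, any level `k`, `λ = 1`, EVERY
schedule): the Lundgren child seeded by the planar Oseen run of heat age `a = 1/(2N_{k+1}²)` (axial scalar `0`;
`H₀ = Γ·(x_k/2 − 1 − log(x_k/2)) ≤ Γx_k/2`) **meets the level-`(k+1)` core clause at every strain time `s` with
`A_k s ≥ 13·(33/32)^k`, provided `Γ ≥ 0.2565·c₁N_{k+1}^{β−2}`** — `PalasekTowerLundgrenChildOseenRun` §5 with the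
endowment lowered from `0.86` by §2, every planar-run hypothesis discharged by `Literature.Analysis.FluidPDE.PlanarLambOseen`.
MODEL statement; not about any registered flow; no `Stage` constructed.
[cite: GallayWayne2005, §1 (the Oseen vortices, display preceding Thm. 1.2), Lemma 3.2 and §3.4; Palasek2026ElementaryModel, §3 (3.2), §3.1] -/
theorem palasekTowerBreakdown_oseenRun_child_coreClause_tuned_allLevels_sharp (Sch : Schedule TowerRates.tuned)
    (k : ℕ) {Γ : ℝ} (hΓ : 0 < Γ) {s : ℝ} (hs13 : 13 * (33 / 32 : ℝ) ^ k ≤ TowerRates.tuned.A k * s)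
    {z₀ : ℝ} (hz₀ : |z₀| ≤ Sch.radius)
    (hC : 0.2565 * Sch.c₁ * TowerRates.tuned.N (k + 1) ^ (TowerRates.tuned.β - 2) ≤ Γ) :
    ∃ (x' : EuclideanSpace ℝ (Fin 3)) (γ : ℝ → EuclideanSpace ℝ (Fin 3)),
      ‖x'‖ ≤ Sch.radius ∧ ContDiff ℝ 1 γ ∧ γ 0 = γ 1 ∧
      (∀ σ ∈ Icc (0 : ℝ) 1, γ σ ∈ Metric.closedBall x' (1 / TowerRates.tuned.N (k + 1))) ∧
      (∀ σ ∈ Icc (0 : ℝ) 1, ‖deriv γ σ‖ ≤ 8 * π / TowerRates.tuned.N (k + 1)) ∧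
      Sch.c₁ * TowerRates.tuned.N (k + 1) ^ (TowerRates.tuned.β - 2) ≤
        circulation (velocity (fun _ => 1 * TowerRates.tuned.A k)
          (fun t y => exp (1 * TowerRates.tuned.A k * t / 2) •
            PlanarLambOseen.velocity Γ 1
              ((exp (1 * TowerRates.tuned.A k * t) - 1) / (1 * TowerRates.tuned.A k) +
                1 / (2 * TowerRates.tuned.N (k + 1) ^ 2))
              (exp (1 * TowerRates.tuned.A k * t / 2) • y))
          (fun t y => exp (-(1 * TowerRates.tuned.A k * t)) •
            (fun (_ : ℝ) (_ : EuclideanSpace ℝ (Fin 2)) => (0 : ℝ))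
              ((exp (1 * TowerRates.tuned.A k * t) - 1) / (1 * TowerRates.tuned.A k))
              (exp (1 * TowerRates.tuned.A k * t / 2) • y)) s) γ := by
  have hA := TowerRates.tuned.A_pos k
  have hN1 := TowerRates.tuned.N_pos (k + 1)
  have hbk : (1 : ℝ) ≤ (33 / 32 : ℝ) ^ k := one_le_pow₀ (by norm_num)
  have hs : 0 < s := by nlinarith
  set c : ℝ := 1 * TowerRates.tuned.A k with hc
  have hcpos : 0 < c := by rw [hc, one_mul]; exact hA
  set a : ℝ := 1 / (2 * TowerRates.tuned.N (k + 1) ^ 2) with ha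
  have hapos : 0 < a := by rw [ha]; positivity
  set T : ℝ := (exp (c * s) - 1) / c with hT
  have hTpos : 0 < T := by
    rw [hT]
    refine div_pos ?_ hcpos
    have : 1 < exp (c * s) := Real.one_lt_exp_iff.2 (mul_pos hcpos hs)
    linarith
  have hmaps : MapsTo (fun t => (exp (c * t) - 1) / c) (Icc 0 s) (Icc 0 T) :=
    mapsTo_lundgrenClock_Icc_sharp hcpos
  have hv := PlanarLambOseen.isClassicalNSSolutionOn_shift_Icc Γ one_pos hapos hTpos
  have hω := PlanarLambOseen.hasUniformRapidDecayOn_planarVorticity_shift one_pos hapos hTpos Γ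
  have hBS := PlanarLambOseen.velocity_shift_eq_biotSavart2D_Icc (α := Γ) one_pos hapos T
  have hinit : ∀ η : EuclideanSpace ℝ (Fin 2),
      PlanarEigenmode.vorticity (PlanarLambOseen.velocity Γ 1 (0 + a)) η =
        Γ / (4 * π * a) * exp (-(‖η‖ ^ 2 / (4 * a))) := by
    intro η
    rw [PlanarLambOseen.vorticity_shift_zero one_ne_zero a η]
    congr 1
    · ring
    · congr 1; ring
  have hfun : PlanarEigenmode.vorticity (PlanarLambOseen.velocity Γ 1 (0 + a)) =
      fun η => Γ / (4 * π * a) * exp (-(‖η‖ ^ 2 / (4 * a))) := funext hinit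
  have hint : ∫ y, PlanarEigenmode.vorticity (PlanarLambOseen.velocity Γ 1 (0 + a)) y = Γ := by
    rw [hfun]; exact integral_heatGaussian hapos Γ
  have h0nn : ∀ η, 0 ≤ PlanarEigenmode.vorticity (PlanarLambOseen.velocity Γ 1 (0 + a)) η :=
    fun η => by rw [hinit η]; positivity
  have hΓ' : 0 < ∫ y, PlanarEigenmode.vorticity (PlanarLambOseen.velocity Γ 1 (0 + a)) y := by
    rw [hint]; exact hΓ
  have hw : IsSmoothSpaceTimeOn (Icc 0 T) (fun (_ : ℝ) (_ : EuclideanSpace ℝ (Fin 2)) => (0 : ℝ)) :=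
    contDiffOn_const
  -- `x_k ≥ 256`, `a·A_k = x_k/2`, the clock `1600 x_k ≤ e^{A_k s}`
  set x : ℝ := 1 * TowerRates.tuned.N k ^ (TowerRates.tuned.β - 2 * TowerRates.tuned.b) with hxdef
  have hx256 : 256 ≤ x := by
    rw [hxdef, one_mul]; exact TowerRates.tuned_coreRatio_ge k
  have hx52 : 52 ≤ x := by linarith
  have hr : a * c = x / 2 := by
    rw [ha, hc, hxdef, ← palasekTowerBreakdown_coreRatio_eq]
    field_simp
  have hK := CoreClock.sub_one_sub_log_le_self (r := x / 2) (by linarith)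
  have hclock0 : 1600 * x ≤ exp (c * s) := by
    rw [hxdef, hc, one_mul, one_mul]
    exact TowerRates.tuned_clock_thirteen k hs13
  -- the hand-over entropy in closed form
  have hH₀ : ∫ η, PlanarEigenmode.vorticity (PlanarLambOseen.velocity Γ 1 (0 + a)) η *
      Real.log (PlanarEigenmode.vorticity (PlanarLambOseen.velocity Γ 1 (0 + a)) η /
        ((∫ y, PlanarEigenmode.vorticity (PlanarLambOseen.velocity Γ 1 (0 + a)) y) / (4 * π * c⁻¹) *
          exp (-(‖η‖ ^ 2 / (4 * c⁻¹))))) = Γ * (a * c - 1 - Real.log (a * c)) := by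
    rw [hint]
    simp only [hinit]
    rw [integral_heatGaussian_mul_log_div hapos (inv_pos.2 hcpos) hΓ, div_inv_eq_mul]
  refine palasekTowerBreakdown_cosigned_child_coreClause_logClock_sharp52 TowerRates.tuned Sch k one_pos
    (convex_Icc 0 T) hv hω hBS h0nn hΓ' hw hmaps (left_mem_Icc.2 hTpos.le) (right_mem_Icc.2 hs.le) hs.le hz₀
    hx52 ?_ ?_
  · rw [hH₀, hint, hr]
    have h1 := mul_le_mul_of_nonneg_left hK hΓ.le
    have h2 := mul_le_mul_of_nonneg_left hclock0 hΓ.le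
    nlinarith
  · rw [hint]; exact hC

end Summit.NavierStokesRegularity.FluidComputer.PalasekTowerClayBridge
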